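import Summits.ResolutionOfSingularities.ResolutionOfSingularities.Theorems.HilbertSamuelEliminationSigmaMaxModificationsCorridor3WLadderLineageGenericPoints
import Summits.ResolutionOfSingularities.ResolutionOfSingularities.Theorems.HilbertSamuelEliminationSigmaMaxModificationsCorridor3WLadderLocalChainsDefs
import Summits.ResolutionOfSingularities.ResolutionOfSingularities.Theorems.HilbertSamuelEliminationSigmaMaxModificationsCorridor3RegularValue
import Summits.ResolutionOfSingularities.ResolutionOfSingularities.Theorems.HilbertSamuelEliminationSigmaMaxModificationsCorridor3NearStep
import Literature.AlgebraicGeometry.CossartJannsenSaito2020.KeyTheoremsLocalLinks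
import Mathlib.Data.Nat.Nth
import HarnessLib

/-!
# [OURS · L1 W4.2] THE TRANSFER ROW (T) `MovingLineageLocalizesM p` — PROVED: a moving lineage along a never-isolated chain of
# canonical near steps localises, at the generic points of its components, to an infinite chain of LOCAL near-point steps on
# reduced excellent local schemes of dimension `≤ 2` with isolated closed points
# (crux chain w42, line `w_ladder`, card H «generic-point descent»; `--supports stmt-ResolutionOfSingularities-19249`, helper)

OURS (cell res-hironaka, slot W4.2, seat res-type-053 gen 9; object D3 «(T) TRANSFER ROW» of res-L1-w42-plan-1's W4.2 DEAL
2026-08-27T07:34:07Z, cut of record 07:55:59Z / 07:57:34Z); NOT a statement of H. Hironaka's manuscript [Hironaka2017] nor of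
[CossartJannsenSaito2020]. AI-drafted, weaker than expert review. Sorry-free PROOF file: no new definition, no named fact, no
binder. The statement proved is res-L1-w42-idea-2's transfer row (`Line-wtop-product` v2.1, card H) as landed VERBATIM by
res-type-040 (`Moving.MovingLineageLocalizesM`, module `…Corridor3WLadderLocalChainsDefs`, p512269); with res-D-pv-046's kill row
(K) it discharges stub-4's (c-geo) `StrataLineageInCentreIO p 3 Q G` for every `Q`, `G` (040's `…Corridor3WLadderLocalChains`).

THE CONSTRUCTION (CJS's «one dimension down», proof of Lemma 6.30 via `X_η`, p. 97; here for a whole chain). Given a maximal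
origin, a chain `c` of canonical near steps from it which is never isolated, and a moving lineage `Z` (components `Z n ∋ x_n` of
`X_n(ν)`, `Z (n+1)` dominating `Z n`, `Z m` inside the canonical centre for infinitely many `m`):
1. `ν ≠ Φ^{(3)}` (a regular value is never blown up, res-L1-w42-stub-1's `IsMaximalOrigin.not_isBlownUp_of_eq_iterPSum`), so every
   stage carries res-L1-w42-stub-4's cycle invariant `CycleInv k R 3 ν (c n)`; the lineage's projections and centres are THE
   chain's (`Helpers.chainProj`, `Helpers.chainCentre`, res-L1-w42-lead-1 p505866; functional oracle).
2. Generic points `η n` of `Z n`; `chainProj n (η (n+1)) = η n`; by `…Corridor3WLadderLineageGenericPoints` (this seat, file A)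
   there is `n₀` after which `η (n+1)` is the only point over `η n` which it specializes to (heights of the `η n` in the
   specialization orders are non-decreasing along the proper projections and bounded by `3`).
3. The hits `m ≥ n₀ + 1` (those with `η m ∈ supp C_m`) form an infinite set, enumerated increasingly by `Nat.nth`; between two
   consecutive hits every step is a miss, hence an isomorphism of local rings at the generic points.
4. `S i := Spec 𝒪_{X_{m_i}, η_{m_i}}` with its closed point. The `i`-th LOCAL NEAR-POINT STEP (`IsLocalNearPointStep 3`): the base
   change `B = X_{m_i+1} ×_{X_{m_i}} Spec 𝒪_{η}` of the step is the blow-up of the closed point (`(C_{m_i})_η = 𝔪_η` at a hit,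
   file A; res-L1-w42-stub-2's `isBlowup_pullback_snd_fromSpecStalk_singleton`, p504248); the lift `b` of `η (m_i+1)` is NEAR
   (`H` is `ν` along the lineage) and CLOSED (step 2: a specialization of `b` lies over the closed point, hence its image in
   `X_{m_i+1}` is a specialization of `η (m_i+1)` over `η (m_i)`, so equals it; `B → X_{m_i+1}` is injective); and
   `S (i+1) ≅ Spec 𝒪_{B,b}` through the stalk isomorphisms `𝒪_{B,b} ≅ 𝒪_{X_{m_i+1},η} ≅ ⋯ ≅ 𝒪_{X_{m_{i+1}},η}` along the misses.
5. `S 0` is excellent and reduced (stalk of a reduced scheme of finite type over a field), of dimension `coheight η ≤ 2`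
   (`height η ≥ 1` because the chain is never isolated: `Z ∋ x_m` is not `{x_m}`, stub-4's
   `CycleInv.singleton_notMem_componentsIn_of_not_iso`); every closed point `pt i` is isolated in the Hilbert–Samuel locus of
   `S i` (file A: proper generizations of `η` have `H < ν` by maximality of the component `Z`).

References: CJS LNM 2270 (2020) Lemma 6.30 (proof via the localisation `X_η`, p. 97), Prop. 6.31, Rem. 6.29 (1), Def. 6.38/6.39,
p. 107 [CossartJannsenSaito2020]; card H `L/res-L1-w42-idea-2/idea-generic-point-descent.md`; HOME/L/w42/CHAIN.md v3.11a.
-/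

noncomputable section

set_option linter.dupNamespace false -- namespace `…Corridor3.Moving` re-enters `…Corridor3` (Moving files' convention)

open CategoryTheory CategoryTheory.Limits AlgebraicGeometry TopologicalSpace Topology IsLocalRing Order
open Summit.ResolutionOfSingularities.ResolutionOfSingularities.Theorems.CampaignW42
open Literature.AlgebraicGeometry.Resolution Literature.RingTheory.HilbertSamuel
open Literature.AlgebraicGeometry.CossartJannsenSaito2020
open Summit.ResolutionOfSingularities.ResolutionOfSingularities.Theorems.SigmaMaxModificationsCorridor3
open Scheme.IdealSheafData

universe u

namespace Summit.ResolutionOfSingularities.ResolutionOfSingularities.Theorems.SigmaMaxModificationsCorridor3.Moving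

variable {R : ∀ S : Scheme.{u}, CentreSeq S → Prop} {N : ℕ} {ν : ℕ → ℕ} {k : Type u} [Field k]
  {c : ℕ → MarkedStage.{u}} (hstep : ∀ n, CanonicalNearStep R N ν (c n) (c (n + 1)))

/-! ## §1 `Spec` of a local ring isomorphic to a stalk is the local scheme there -/

/-- A ring isomorphism `𝒪_{X,x} ≅ A` exhibits `Spec A` (with its closed point) as the local scheme of `X` at `x`. [folklore] -/
theorem isLocalSchemeAt_Spec_of_iso {X : Scheme.{u}} {x : X} {A : CommRingCat.{u}} [IsLocalRing A]
    (e : X.presheaf.stalk x ≅ A) : IsLocalSchemeAt (Spec A) (closedPoint A) X x := by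
  haveI : IsLocalHom e.hom.hom := isLocalHom_of_iso e
  exact ⟨asIso (Spec.map e.hom), Spec_closedPoint⟩

/-! ## §2 Stalk isomorphisms along an interval of misses -/

/-- **Along consecutive MISSES the local rings at the generic points do not change**: if no `η (a + i)`, `i < j`, lies in the
centre `C_{a+i}`, then `𝒪_{X_a, η_a} ≅ 𝒪_{X_{a+j}, η_{a+j}}` (each step is a local isomorphism at the generic point, file A
`isIso_stalkMap_chainProj_of_notMem`). [cite: StacksProject, Tag 02OS] -/
theorem nonempty_stalkIso_of_misses {η : ∀ n, (c n).W}
    (hover : ∀ n, (Helpers.chainProj hstep n).base (η (n + 1)) = η n) (a : ℕ) :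
    ∀ j : ℕ, (∀ i, i < j → η (a + i) ∉ ((Helpers.chainCentre hstep (a + i)).support : Set (c (a + i)).W)) →
      Nonempty ((c a).W.presheaf.stalk (η a) ≅ (c (a + j)).W.presheaf.stalk (η (a + j)))
  | 0, _ => ⟨Iso.refl _⟩
  | j + 1, hmiss => by
    obtain ⟨e⟩ := nonempty_stalkIso_of_misses hover a j fun i hi => hmiss i (Nat.lt_succ_of_lt hi)
    have hnot : (Helpers.chainProj hstep (a + j)).base (η (a + j + 1)) ∉
        ((Helpers.chainCentre hstep (a + j)).support : Set (c (a + j)).W) := by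
      rw [hover]
      exact hmiss j (Nat.lt_succ_self j)
    haveI := isIso_stalkMap_chainProj_of_notMem hstep hnot
    let e₁ : (c (a + j)).W.presheaf.stalk (η (a + j)) ≅
        (c (a + j)).W.presheaf.stalk ((Helpers.chainProj hstep (a + j)).base (η (a + j + 1))) :=
      eqToIso (by rw [hover])
    exact ⟨e ≪≫ e₁ ≪≫ asIso ((Helpers.chainProj hstep (a + j)).stalkMap (η (a + j + 1)))⟩

/-! ## §3 One local near-point step -/

/-- **A LOCAL NEAR-POINT STEP FROM A BLOW-UP WHOSE CENTRE IS THE MAXIMAL IDEAL AT `x`.** Let `π : X' → X` be a blow-up in a radical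
centre `C` with `C_x = 𝔪_x`, and `x'` a point over `x` with the same `H^N` which is the ONLY point over `x` it specializes to. Then
for every `(S', s')` which is the local scheme of `X'` at `x'`, `IsLocalNearPointStep N (Spec 𝒪_{X,x}) 𝔪 S' s'`: the base change
`X' ×_X Spec 𝒪_{X,x} → Spec 𝒪_{X,x}` is the blow-up of the closed point (res-L1-w42-stub-2, p504248), the lift `b` of `x'` lies over
the closed point, is near, is CLOSED (a specialization of `b` lies over the closed point, so its image in `X'` is a specialization
of `x'` over `x`, i.e. `x'`; and `X' ×_X Spec 𝒪_{X,x} → X'` is injective), and `𝒪_b ≅ 𝒪_{X',x'}`.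
[cite: CossartJannsenSaito2020, Def. 6.38, p. 107] -/
theorem isLocalNearPointStep_of_isBlowup {X' X : Scheme.{u}} [IsLocallyNoetherian X] [IsLocallyNoetherian X'] {π : X' ⟶ X}
    {C : X.IdealSheafData} (hπ : IsBlowup π C) (hrad : C = vanishingIdeal C.support) {x : X}
    (hmax : stalkIdeal C x = maximalIdeal (X.presheaf.stalk x)) (N : ℕ) {x' : X'} (hover : π.base x' = x)
    (hnear : Scheme.hsFun X' N x' = Scheme.hsFun X N x) (huniq : ∀ y : X', x' ⤳ y → π.base y = x → y = x')
    {S' : Scheme.{u}} {s' : S'} (hS' : IsLocalSchemeAt S' s' X' x') :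
    IsLocalNearPointStep N (Spec (X.presheaf.stalk x)) (closedPoint (X.presheaf.stalk x)) S' s' := by
  have hc : (X.fromSpecStalk x).base (closedPoint (X.presheaf.stalk x)) = x := Scheme.fromSpecStalk_closedPoint
  haveI : IsLocallyNoetherian (pullback π (X.fromSpecStalk x)) := isLocallyNoetherian_pullback_fromSpecStalk hπ x
  -- the lift of `x'`
  obtain ⟨b, hb, hbs, hbiso⟩ := exists_lift_pullback_fromSpecStalk π x hover
  have hsnd : (pullback.snd π (X.fromSpecStalk x)).base b = closedPoint (X.presheaf.stalk x) :=
    eq_closedPoint_of_fromSpecStalk_eq hbs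
  refine ⟨isLocalAt_Spec_closedPoint _, pullback π (X.fromSpecStalk x), pullback.snd π (X.fromSpecStalk x),
    vanishingIdeal ⟨{closedPoint (X.presheaf.stalk x)}, isClosed_singleton_of_fromSpecStalk_eq hc⟩, b,
    isBlowup_pullback_snd_fromSpecStalk_singleton hπ hrad hmax hc,
    stalkIdeal_vanishingIdeal_singleton (isClosed_singleton_of_fromSpecStalk_eq hc), hsnd,
    hsFun_lift_eq_hsFun_closedPoint π x N hb hnear, ?_, ?_⟩
  · -- closed: a specialization `b ⤳ b'` lies over the closed point, so its image in `X'` is `x'`, so `b' = b`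
    have hcl : closure ({b} : Set ↥(pullback π (X.fromSpecStalk x))) ⊆ {b} := by
      intro b' hb'
      have hbb' : b ⤳ b' := specializes_iff_mem_closure.mpr hb'
      have h1 : x' ⤳ (pullback.fst π (X.fromSpecStalk x)).base b' :=
        hb ▸ hbb'.map (pullback.fst π (X.fromSpecStalk x)).continuous
      have h2 : (pullback.snd π (X.fromSpecStalk x)).base b' = closedPoint (X.presheaf.stalk x) := by
        have hsp : closedPoint (X.presheaf.stalk x) ⤳ (pullback.snd π (X.fromSpecStalk x)).base b' :=
          hsnd ▸ hbb'.map (pullback.snd π (X.fromSpecStalk x)).continuous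
        exact Set.mem_singleton_iff.mp (hsp.mem_closed (isClosed_singleton_of_fromSpecStalk_eq hc) rfl)
      have h3 : π.base ((pullback.fst π (X.fromSpecStalk x)).base b') = x := by
        have h' : (pullback.fst π (X.fromSpecStalk x) ≫ π).base b' =
            (pullback.snd π (X.fromSpecStalk x) ≫ X.fromSpecStalk x).base b' := by
          rw [pullback.condition]
        rw [Scheme.Hom.comp_base, Scheme.Hom.comp_base, TopCat.comp_app, TopCat.comp_app, h2, hc] at h'
        exact h'
      have h4 := huniq _ h1 h3
      have hinj : Function.Injective (pullback.fst π (X.fromSpecStalk x)).base :=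
        (pullback.fst π (X.fromSpecStalk x)).isEmbedding.injective
      exact Set.mem_singleton_iff.mpr (hinj (h4.trans hb.symm))
    exact isClosed_of_closure_subset hcl
  · -- the local scheme of the base change at `b` is that of `X'` at `x'`
    obtain ⟨e, he⟩ := hS'
    subst hb
    haveI := hbiso
    let φ := asIso ((pullback.fst π (X.fromSpecStalk x)).stalkMap b)
    haveI : IsLocalHom φ.inv.hom := isLocalHom_of_iso φ.symm
    refine ⟨e ≪≫ asIso (Spec.map φ.inv), ?_⟩
    show (Spec.map φ.inv).base (e.hom.base s') = closedPoint _
    rw [he]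
    exact Spec_closedPoint

/-- **THE LOCAL NEAR-POINT STEP AT A HIT OF A LINEAGE.** At a stage under the cycle invariant (`ν ≠ Φ^{(N)}`, admissible oracle),
let `η` be the generic point of a component `Z` of `X_n(ν)` contained in the centre `C_n`, and `η'` a point of `X_{n+1}(ν)` over
`η` which is the only point over `η` it specializes to. Then every local scheme `(S', s')` of `X_{n+1}` at `η'` receives a local
near-point step from `Spec 𝒪_{X_n,η}` (`(C_n)_η = 𝔪_η`, file A). [cite: CossartJannsenSaito2020, Lemma 6.30, Def. 6.38, p. 107] -/
theorem isLocalNearPointStep_of_hit (hRa : OracleAdmissible R) (hν : ν ≠ iterPSum N Phi) {n : ℕ}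
    (hinv : CycleInv k R N ν (c n)) {Z : Set (c n).W} (hZ : Z ∈ componentsIn (Scheme.hsStratum (c n).W N ν)) {η : (c n).W}
    (hη : IsGenericPoint η Z) (hZC : Z ⊆ ((Helpers.chainCentre hstep n).support : Set (c n).W)) {η' : (c (n + 1)).W}
    (hover : (Helpers.chainProj hstep n).base η' = η) (hη'ν : η' ∈ Scheme.hsStratum (c (n + 1)).W N ν)
    (huniq : ∀ y : (c (n + 1)).W, η' ⤳ y → (Helpers.chainProj hstep n).base y = η → y = η')
    {S' : Scheme.{u}} {s' : S'} (hS' : IsLocalSchemeAt S' s' (c (n + 1)).W η') :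
    IsLocalNearPointStep N (Spec ((c n).W.presheaf.stalk η)) (closedPoint ((c n).W.presheaf.stalk η)) S' s' := by
  haveI : IsLocallyNoetherian (c n).W := (c n).ln
  haveI : IsLocallyNoetherian (c (n + 1)).W := (c (n + 1)).ln
  have hnear : Scheme.hsFun (c (n + 1)).W N η' = Scheme.hsFun (c n).W N η := by
    rw [Scheme.mem_hsStratum_iff.mp hη'ν]
    exact (Scheme.mem_hsStratum_iff.mp (componentsIn.subset hZ hη.mem)).symm
  exact isLocalNearPointStep_of_isBlowup (Helpers.isBlowup_chainProj hstep n)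
    (chainCentre_eq_vanishingIdeal_support' hstep hRa hν hinv)
    (stalkIdeal_chainCentre_eq_maximalIdeal_of_subset hstep hRa hν hinv hZ hη hZC) N hover hnear huniq hS'

/-! ## §4 The transfer row -/

/-- **THE TRANSFER ROW (T), PROVED — `MovingLineageLocalizesM p` for every `p`.** A moving lineage along a never-isolated chain of
canonical near steps from a maximal origin localises to an infinite chain of local near-point steps `(S_i, s_i)` with `S_0`
excellent, reduced, of dimension `≤ 2`, and every `s_i` isolated in the Hilbert–Samuel locus of `S_i` (module docstring for the
construction). [cite: CossartJannsenSaito2020, Lemma 6.30, Prop. 6.31, p. 107] -/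
theorem movingLineageLocalizesM_holds (p : ℕ) : MovingLineageLocalizesM.{u} p := by
  intro R hRf hRa ν X _ x hX c h0 hstep hnot Z hZ
  -- 1. `ν ≠ Φ^{(3)}`, cycle invariant, the chain's projections and centres
  have hν : ν ≠ iterPSum 3 Phi := by
    intro hνeq
    obtain ⟨m, -, hbu⟩ := hZ.isBlownUp_io 0
    exact hX.not_isBlownUp_of_eq_iterPSum hRf hRa hνeq (reaches_chain h0 hstep m) (hstep m) hbu
  obtain ⟨k, _, hinv⟩ := exists_cycleInv_chain hRa hν hX h0 hstep
  obtain ⟨hZcomp, hZdom, hZhit⟩ := hZ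
  have hpt : ∀ n, (c n).pt ∈ Scheme.hsStratum (c n).W 3 ν := fun n =>
    pt_mem_hsStratum_of_reaches hX.mem_stratum (reaches_chain h0 hstep n)
  have hptcl : ∀ n, IsClosed ({(c n).pt} : Set (c n).W) := fun n =>
    Reaches.isClosed_pt hX.isClosed (reaches_chain h0 hstep n)
  have hZcl : ∀ n, IsClosed (Z n) := fun n => componentsIn.isClosed (hinv n).isClosed_hsStratum (hZcomp n).1
  have hZirr : ∀ n, IsIrreducible (Z n) := fun n => componentsIn.isIrreducible (hZcomp n).1
  -- 2. generic points
  let η : ∀ n, (c n).W := fun n => (hZirr n).genericPoint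
  have hη : ∀ n, IsGenericPoint (η n) (Z n) := fun n => by
    have h := (hZirr n).isGenericPoint_genericPoint_closure
    rwa [(hZcl n).closure_eq] at h
  have hdom : ∀ n, closure ((Helpers.chainProj hstep n).base '' Z (n + 1)) = Z n := fun n => by
    obtain ⟨g, hg, hgZ⟩ := hZdom n
    rwa [hg.unique hRf (Helpers.stepProjection_chainProj hstep n)] at hgZ
  have hover : ∀ n, (Helpers.chainProj hstep n).base (η (n + 1)) = η n :=
    chainProj_base_genericPoint hstep hη hdom
  have hην : ∀ n, η n ∈ Scheme.hsStratum (c n).W 3 ν := fun n => componentsIn.subset (hZcomp n).1 (hη n).mem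
  have hptne : ∀ n, (c n).pt ≠ η n := fun n h => by
    have hZs : Z n = {(c n).pt} := by rw [← (hη n).def, ← h, (hptcl n).closure_eq]
    exact (hinv n).singleton_notMem_componentsIn_of_not_iso (hpt n) (hnot n) (hZs ▸ (hZcomp n).1)
  -- hits in terms of the chain's centres
  have hhit : ∀ n, ∃ m, n ≤ m ∧ η m ∈ ((Helpers.chainCentre hstep m).support : Set (c m).W) := fun n => by
    obtain ⟨m, hnm, C', P', hcs', hZC'⟩ := hZhit n
    obtain ⟨P, hcs⟩ := Helpers.isCanonicalStep_chainCentre hstep m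
    have hCC : C' = Helpers.chainCentre hstep m := hcs'.centre_unique hRf hcs
    subst hCC
    exact ⟨m, hnm, hZC' (hη m).mem⟩
  -- the tail on which fibres are «closed»
  obtain ⟨n₀, huniq⟩ := exists_forall_eq_genericPoint_of_specializes hstep hinv hη hdom
  -- 3. the hits after `n₀`, enumerated
  let P : ℕ → Prop := fun m => n₀ ≤ m ∧ η m ∈ ((Helpers.chainCentre hstep m).support : Set (c m).W)
  have hPinf : (setOf P).Infinite := by
    refine Set.infinite_of_forall_exists_gt fun n => ?_
    obtain ⟨m, hnm, hm⟩ := hhit (max n₀ n + 1)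
    exact ⟨m, ⟨le_trans (le_max_left _ _) (Nat.le_of_succ_le hnm), hm⟩, lt_of_lt_of_le (Nat.lt_succ_of_le (le_max_right _ _)) hnm⟩
  let mH : ℕ → ℕ := Nat.nth P
  have hmH : ∀ i, P (mH i) := Nat.nth_mem_of_infinite hPinf
  have hmHmono : StrictMono mH := Nat.nth_strictMono hPinf
  have hmiss : ∀ i j, j < mH (i + 1) - (mH i + 1) →
      η (mH i + 1 + j) ∉ ((Helpers.chainCentre hstep (mH i + 1 + j)).support : Set (c (mH i + 1 + j)).W) := by
    intro i j hj hmem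
    have hlt : mH i + 1 + j < mH (i + 1) := by omega
    have hPm : P (mH i + 1 + j) := ⟨le_trans (hmH i).1 (by omega), hmem⟩
    have := Nat.le_nth_of_lt_nth_succ hlt hPm
    change mH i + 1 + j ≤ mH i at this
    omega
  -- 4. the local schemes
  let S : ℕ → Scheme.{u} := fun i => Spec ((c (mH i)).W.presheaf.stalk (η (mH i)))
  have ln : ∀ i, IsLocallyNoetherian (S i) := fun i => by
    haveI := (c (mH i)).ln
    show IsLocallyNoetherian (Spec _)
    infer_instance
  let pt : ∀ i, S i := fun i => closedPoint ((c (mH i)).W.presheaf.stalk (η (mH i)))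
  refine ⟨S, ln, pt, (hinv (mH 0)).isExcellent_Spec_stalk _, (hinv (mH 0)).isReduced_Spec_stalk _, ?_, ?_, ?_⟩
  · -- dimension `≤ 2`
    exact topologicalKrullDim_Spec_stalk_le_of_isGenericPoint (hη (mH 0)) (hZcomp (mH 0)).2 (hptne (mH 0)) (d := 2)
      (hinv (mH 0)).dim_le
  · -- the chain of local near-point steps
    intro i
    -- the local scheme `S (i+1)` is that of `X_{mH i + 1}` at `η (mH i + 1)` (misses in between)
    have hgap : mH i + 1 + (mH (i + 1) - (mH i + 1)) = mH (i + 1) := by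
      have hlt : mH i < mH (i + 1) := hmHmono (Nat.lt_succ_self i)
      omega
    obtain ⟨e⟩ := nonempty_stalkIso_of_misses hstep hover (mH i + 1) (mH (i + 1) - (mH i + 1)) (hmiss i)
    have hS' : IsLocalSchemeAt (S (i + 1)) (pt (i + 1)) (c (mH i + 1)).W (η (mH i + 1)) := by
      have e' : (c (mH i + 1)).W.presheaf.stalk (η (mH i + 1)) ≅ (c (mH (i + 1))).W.presheaf.stalk (η (mH (i + 1))) :=
        e ≪≫ eqToIso (by rw [hgap])
      exact isLocalSchemeAt_Spec_of_iso e'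
    exact isLocalNearPointStep_of_hit hstep hRa hν (hinv (mH i)) (hZcomp (mH i)).1 (hη (mH i))
      (((hη (mH i)).mem_closed_set_iff (Helpers.chainCentre hstep (mH i)).support.isClosed).mp (hmH i).2)
      (hover (mH i)) (hην (mH i + 1)) (huniq (mH i) (hmH i).1) hS'
  · -- isolation
    intro i
    exact (hinv (mH i)).isIsolatedInHSMaxLocus_closedPoint_of_isGenericPoint (hZcomp (mH i)).1 (hη (mH i))

end Summit.ResolutionOfSingularities.ResolutionOfSingularities.Theorems.SigmaMaxModificationsCorridor3.Moving

end
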